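import Literature.NumberTheory.EllipticCurves.IwasawaSelmerDualProofs
import HarnessLib

/-!
# The `p^∞`-Selmer group RELAXED AT THE INFINITE PLACES, `Sel^{rel ∞}_{p^∞}(E/K_∞)`, over a `ℤ_p`-extension and its
# Pontryagin dual `X^{rel ∞}(E/K_∞)` as a `Λ`-module (definitions + constructed existence; nothing asserted)

HONEST FRAMING: DEFINITIONS and unfolding / comparison lemmas, plus the CONSTRUCTED dual datum (existence); no named fact,
nothing is asserted. This is the classical-Selmer twin of `KatoFineSelmerDualRelaxedAtInfinity` (the relaxed-at-`∞` FINE Selmer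
group `Sel₀^{rel ∞}` and its dual datum `FineSelmerDualDataRelaxedInf`), requested by the cell `bsd-2adic` (pen RC-406 (2) (a), lane
«relaxed-genuine» of crux `OrdKatoHalfAtTwoIso`): the tree's `WeierstrassCurve.selmerGroupOver p H` (file `SubgroupSelmer`) imposes
the Kummer local condition at the chosen place above EVERY place of `K`, the infinite places included — for a real place `w` and
`p = 2` the local condition is `c ↦ 0 ∈ H¹(K_w, E(K̄_w))[2^∞] ≅ H¹(ℝ, E[2^∞])`, a group of order `1` or `2` (order `2` iff
`E[2] ⊂ E(K_w)`, i.e. `Δ_E > 0` at that place), so `Sel_{2^∞}` is STRICT AT `∞`. Dropping the archimedean clause gives the Selmer group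
RELAXED AT `∞`, `Sel^{rel ∞} ⊇ Sel`; over the cyclotomic `ℤ₂`-extension of `ℚ` the quotient is controlled by Poitou–Tate:
`(Sel^{rel ∞}/Sel)^∨ ≅ H¹(ℝ, T₂E)⟦Γ⟧`, which is `Λ/2Λ` if `Δ_E > 0` and `0` if `Δ_E < 0`, whence `μ(X^{rel ∞}) = μ(X) + ord₂ c_∞(E)`
(the archimedean factor `𝒫_E^{(v)}(F_∞) ≅ Hom(Λ/2Λ, ℤ/2ℤ)` of Greenberg, LNM 1716, §4, Lemma 4.6 and PDF pp. 105–107; «every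
compatible family of signs at the real places of the `ℚ_n` is realised by relaxed Selmer classes», cf. Greenberg's Prop. 5.8 in the
reducible case). None of these comparison statements is asserted here; this file only TYPES the objects they speak about, so that
Summits-side doors can display them by name.

Contents (mirroring `IwasawaSelmer` (c)/(d) and `IwasawaSelmerDualProofs` (Z) declaration by declaration):
* §1 `WeierstrassCurve.selmerGroupOverRelaxedInf W p H` — `selmerGroupOver` WITHOUT the archimedean clause; `mem_…_iff`,
  `selmerGroupOver_le_relaxedInf`, `conjH1`-stability (proved from `conjH1_mul`).
* §2 `WeierstrassCurve.selmerInftyRelaxedInf W κ` — the case `H = ker κ`; `selmerInfty ≤ selmerInftyRelaxedInf`; the hypothesis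
  structure `WeierstrassCurve.SelmerDualDataRelaxedInf W κ γ` — EXACTLY the pattern of `SelmerDualData` with `Sel` replaced by
  `Sel^{rel ∞}` (and no `conj_mem` field: stability is a theorem here); `charIdeal`, `mu`, `lambda`, `toSelmerDual` (restriction of
  characters to `Sel ≤ Sel^{rel ∞}`).
* §3 EXISTENCE (proved, word for word `IwasawaSelmerDualProofs` (Z)): `conjSelmerInftyRelaxedInf`, local nilpotence of
  `conj_γ − 1`, the CONSTRUCTED datum `selmerDualDataRelaxedInf κ hγ`, `nonempty_selmerDualDataRelaxedInf`,
  `exists_selmerDualDataRelaxedInf` (non-vacuity of every «`∀ D : W.SelmerDualDataRelaxedInf κ γ, …`»).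

References: R. Greenberg, LNM 1716 (1999) §1 p. 60, §4 Lemma 4.6 (PDF pp. 105–107), Prop. 5.8 [GreenbergLNM1716]; R. Greenberg,
Adv. Stud. Pure Math. 17 (1989) §1 p. 98 [Greenberg1989]; B. Mazur, Invent. Math. 18 (1972) §6 [MazurInvent1972]; J. Coates,
R. Sujatha, Math. Ann. 331 (2005) §3 [CoatesSujatha2005].
-/

noncomputable section

open scoped Classical

open NumberField IsDedekindDomain Field
open Literature.NumberTheory.GaloisRepresentations Literature.NumberTheory.EllipticCurves

universe u

namespace WeierstrassCurve

/-! ## §1 The Selmer group over `L = K̄^H`, relaxed at the infinite places -/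

section Over

variable {K : Type u} [Field K] [NumberField K] (W : WeierstrassCurve K) (p : ℕ)
  (H : Subgroup (Field.absoluteGaloisGroup K)) [H.Normal]

/-- **The `p^∞`-Selmer group over `L = K̄^H`, RELAXED AT THE INFINITE PLACES**, `Sel^{rel ∞}_{p^∞}(E/L) ⊆ H¹(H, E[p^∞])`: the
classes `c` such that `conj_σ c` dies in `H¹(H_{K_v}, E(K̄_v))` for every FINITE place `v` and every `σ ∈ Γ_K` — i.e.
`selmerGroupOver` with the archimedean family of conditions REMOVED (no condition at the infinite places; for `p = 2` and real
places this is a genuinely larger group, for `p` odd or `K` totally imaginary it is the same group).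
[cite: GreenbergLNM1716, §4, before Lemma 4.6 (PDF p. 106): the archimedean factor at p = 2] [cite: MazurInvent1972, §6] -/
def selmerGroupOverRelaxedInf : AddSubgroup (W.subgroupH1 p H) :=
  ⨅ (v : HeightOneSpectrum (𝓞 K)) (σ : Field.absoluteGaloisGroup K),
    (W.localKerOver p H (v.adicCompletion K)).comap (W.conjH1 p H σ)

variable {W p H}

/-- Membership in `Sel^{rel ∞}_{p^∞}(E/L)`: the finite local conditions at all conjugates, and nothing at the infinite places.
[cite: GreenbergLNM1716, §2 and §4 (PDF p. 106)] -/
theorem mem_selmerGroupOverRelaxedInf_iff (c : W.subgroupH1 p H) :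
    c ∈ W.selmerGroupOverRelaxedInf p H ↔
      ∀ (v : HeightOneSpectrum (𝓞 K)) (σ : Field.absoluteGaloisGroup K),
        W.conjH1 p H σ c ∈ W.localKerOver p H (v.adicCompletion K) := by
  simp only [selmerGroupOverRelaxedInf, AddSubgroup.mem_iInf, AddSubgroup.mem_comap]

variable (W p H) in
/-- The Selmer group is contained in its relaxed-at-`∞` version (one forgets the archimedean conditions).
[cite: GreenbergLNM1716, §4, before Lemma 4.6 (PDF p. 106)] -/
theorem selmerGroupOver_le_relaxedInf : W.selmerGroupOver p H ≤ W.selmerGroupOverRelaxedInf p H := by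
  intro c hc
  rw [mem_selmerGroupOver_iff] at hc
  rw [mem_selmerGroupOverRelaxedInf_iff]
  exact hc.1

variable (W p H) in
/-- When every archimedean local condition is vacuous (`localKerOver p H w.Completion = ⊤` for all infinite `w` — e.g. `p` odd,
or no real place, or `E[2] ⊄ E(K_w)`), relaxing at `∞` changes nothing. [cite: GreenbergLNM1716, §4, before Lemma 4.6 (PDF p. 106)] -/
theorem selmerGroupOverRelaxedInf_eq_of_localKerOver_eq_top
    (h : ∀ w : InfinitePlace K, W.localKerOver p H w.Completion = ⊤) :
    W.selmerGroupOverRelaxedInf p H = W.selmerGroupOver p H := by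
  refine le_antisymm (fun c hc ↦ ?_) (W.selmerGroupOver_le_relaxedInf p H)
  rw [mem_selmerGroupOverRelaxedInf_iff] at hc
  rw [mem_selmerGroupOver_iff]
  exact ⟨hc, fun w σ ↦ by rw [h w]; exact AddSubgroup.mem_top _⟩

/-- `Sel^{rel ∞}_{p^∞}(E/L)` is stable under the conjugation action of `Γ_K` (the finite local conditions are permuted by `γ`:
`conj_σ ∘ conj_γ = conj_{σγ}`), so `Γ_K/H` acts on it. [cite: GreenbergLNM1716, §1 p. 60 (after Conj. 1.3)] -/
theorem conjH1_mem_selmerGroupOverRelaxedInf (γ : Field.absoluteGaloisGroup K) {c : W.subgroupH1 p H}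
    (hc : c ∈ W.selmerGroupOverRelaxedInf p H) : W.conjH1 p H γ c ∈ W.selmerGroupOverRelaxedInf p H := by
  have e : ∀ σ : Field.absoluteGaloisGroup K, W.conjH1 p H σ (W.conjH1 p H γ c) = W.conjH1 p H (σ * γ) c :=
    fun σ ↦ by rw [W.conjH1_mul_holds p H σ γ]; rfl
  rw [mem_selmerGroupOverRelaxedInf_iff] at hc ⊢
  intro v σ
  rw [e]
  exact hc v (σ * γ)

end Over

/-! ## §2 Over the top of a `ℤ_p`-extension: `Sel^{rel ∞}_{p^∞}(E/K_∞)` and its dual datum -/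

section Tower

variable {K : Type u} [Field K] [NumberField K] (W : WeierstrassCurve K) {p : ℕ} [Fact p.Prime]
  (κ : ZpExtension K p) (γ : Field.absoluteGaloisGroup K)

/-- **`Sel^{rel ∞}_{p^∞}(E/K_∞)`**: the `p^∞`-Selmer group of `W` over the top of the `ℤ_p`-extension `κ`, relaxed at the infinite
places, inside `H¹(K_∞, E[p^∞]) = W.subgroupH1 p κ.kerSubgroup` (`selmerGroupOverRelaxedInf` for `H = ker κ`).
[cite: GreenbergLNM1716, §4, Lemma 4.6 and PDF pp. 105–107] [cite: MazurInvent1972, §6] -/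
def selmerInftyRelaxedInf : AddSubgroup (W.subgroupH1 p κ.kerSubgroup) :=
  W.selmerGroupOverRelaxedInf p κ.kerSubgroup

/-- Unfolding (definitional). [cite: MazurInvent1972, §6] -/
theorem selmerInftyRelaxedInf_eq : W.selmerInftyRelaxedInf κ = W.selmerGroupOverRelaxedInf p κ.kerSubgroup := rfl

/-- `Sel_{p^∞}(E/K_∞) ≤ Sel^{rel ∞}_{p^∞}(E/K_∞)`. [cite: GreenbergLNM1716, §4, before Lemma 4.6 (PDF p. 106)] -/
theorem selmerInfty_le_selmerInftyRelaxedInf : W.selmerInfty κ ≤ W.selmerInftyRelaxedInf κ :=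
  W.selmerGroupOver_le_relaxedInf p κ.kerSubgroup

/-- `Sel^{rel ∞}_{p^∞}(E/K_∞)` is stable under `conj_γ`. [cite: GreenbergLNM1716, §1 p. 60 (after Conj. 1.3)] -/
theorem conjH1_mem_selmerInftyRelaxedInf {s : W.subgroupH1 p κ.kerSubgroup} (hs : s ∈ W.selmerInftyRelaxedInf κ) :
    W.conjH1 p κ.kerSubgroup γ s ∈ W.selmerInftyRelaxedInf κ :=
  W.conjH1_mem_selmerGroupOverRelaxedInf γ hs

/-- **Pontryagin-dual data for `Sel^{rel ∞}_{p^∞}(E/K_∞)`** (hypothesis structure — EXACTLY the pattern of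
`WeierstrassCurve.SelmerDualData` with `Sel` replaced by `Sel^{rel ∞}`; no `conj_mem` field, stability being the theorem
`conjH1_mem_selmerInftyRelaxedInf`): the Iwasawa module `X^{rel ∞}(E/K_∞) = Hom(Sel^{rel ∞}_{p^∞}(E/K_∞), ℚ_p/ℤ_p)` as an abstract
`Λ = ℤ_p⟦T⟧`-module `X` with `toDual : X ≃ Hom(Sel^{rel ∞}, ℚ/ℤ)` (`bijective`), `T` acting as `γ − 1` (`toDual_T_smul`) and constants
`c ∈ ℤ_p` acting on `p^k`-torsion classes through `ℤ_p → ℤ/p^k` (`toDual_C_smul`). For `p = 2`, `K = ℚ` and `Δ_E > 0`, `X^{rel ∞}` is an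
extension of `X` by `(Sel^{rel ∞}/Sel)^∨ ≅ Λ/2Λ` (Greenberg's archimedean factor) — a comparison NOT asserted here.
[cite: GreenbergLNM1716, §1 p. 60 and §4, Lemma 4.6 (PDF pp. 105–107)] [cite: MazurInvent1972, §6] -/
structure SelmerDualDataRelaxedInf where
  /-- The underlying type of the Iwasawa module `X^{rel ∞}(E/K_∞)`. -/
  X : Type u
  /-- `X^{rel ∞}` is an abelian group. -/
  [addCommGroup : AddCommGroup X]
  /-- `X^{rel ∞}` is a `Λ = ℤ_p⟦T⟧`-module. -/
  [module : Module (IwasawaAlgebra p) X]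
  /-- The identification of `X^{rel ∞}` with the character group `Hom(Sel^{rel ∞}_{p^∞}(E/K_∞), ℚ/ℤ)`. -/
  toDual : X →+ (W.selmerInftyRelaxedInf κ →+ AddCircle (1 : ℚ))
  /-- `toDual` is a group isomorphism. -/
  bijective : Function.Bijective toDual
  /-- `T` acts as `γ - 1`: `(T·x)(s) = x(conj_γ s) - x(s)`. -/
  toDual_T_smul : ∀ (x : X) (s : W.selmerInftyRelaxedInf κ),
    toDual ((PowerSeries.X : IwasawaAlgebra p) • x) s =
      toDual x ⟨W.conjH1 p κ.kerSubgroup γ s, W.conjH1_mem_selmerInftyRelaxedInf κ γ s.2⟩ - toDual x s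
  /-- Constants `c ∈ ℤ_p` act on `p^k`-torsion classes through `ℤ_p → ℤ/p^k`. -/
  toDual_C_smul : ∀ (c : ℤ_[p]) (x : X) (s : W.selmerInftyRelaxedInf κ) (k : ℕ), (p ^ k) • s = 0 →
    toDual (PowerSeries.C c • x) s = (PadicInt.toZModPow k c).val • toDual x s

attribute [instance] SelmerDualDataRelaxedInf.addCommGroup SelmerDualDataRelaxedInf.module

namespace SelmerDualDataRelaxedInf

variable {W κ γ} (D : W.SelmerDualDataRelaxedInf κ γ)

/-- The **characteristic ideal** `char_Λ X^{rel ∞}(E/K_∞) ⊆ Λ` of the dual of the Selmer group relaxed at `∞`.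
[cite: GreenbergLNM1716, §1 p. 60 and §4 Lemma 4.6] -/
def charIdeal : Ideal (IwasawaAlgebra p) :=
  Literature.NumberTheory.EllipticCurves.Module.charIdeal (IwasawaAlgebra p) D.X

/-- The **`μ`-invariant** of `X^{rel ∞}(E/K_∞)` (`muInvariant`; junk `0` unless finitely generated torsion). For `p = 2`, `K = ℚ`:
`μ(X^{rel ∞}) = μ(X) + ord₂ c_∞(E)` by Poitou–Tate — NOT asserted here. [cite: GreenbergLNM1716, §4 Lemma 4.6 (PDF pp. 105–107)] -/
def mu : ℕ :=
  muInvariant p D.X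

/-- The **`λ`-invariant** of `X^{rel ∞}(E/K_∞)` (`lambdaInvariant`; junk `0` unless finitely generated torsion); `λ(X^{rel ∞}) = λ(X)`
(`λ(Λ/2) = 0`) — NOT asserted here. [cite: GreenbergLNM1716, §4 Lemma 4.6 (PDF pp. 105–107)] -/
def lambda : ℕ :=
  lambdaInvariant p D.X

/-- The restriction `Hom(Sel^{rel ∞}, ℚ/ℤ) → Hom(Sel, ℚ/ℤ)` dual to the inclusion `Sel ≤ Sel^{rel ∞}`, read on `X^{rel ∞}`:
`x ↦ (toDual x) ∘ incl` — the additive map underlying `X^{rel ∞} ↠ X`, whose kernel `(Sel^{rel ∞}/Sel)^∨` is Greenberg's archimedean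
`Λ/2Λ` (for `Δ_E > 0`, `p = 2`) or `0`. [cite: GreenbergLNM1716, §4, Lemma 4.6 and PDF pp. 105–107] -/
def toSelmerDual : D.X →+ (W.selmerInfty κ →+ AddCircle (1 : ℚ)) where
  toFun x := (D.toDual x).comp (AddSubgroup.inclusion (W.selmerInfty_le_selmerInftyRelaxedInf κ))
  map_zero' := by ext s; simp
  map_add' x y := by ext s; simp

/-- Unfolding of `toSelmerDual`. [cite: GreenbergLNM1716, §4, Lemma 4.6] -/
theorem toSelmerDual_apply (x : D.X) (s : W.selmerInfty κ) :
    D.toSelmerDual x s = D.toDual x (AddSubgroup.inclusion (W.selmerInfty_le_selmerInftyRelaxedInf κ) s) := rfl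

end SelmerDualDataRelaxedInf

end Tower

/-! ## §3 Existence of the dual datum (non-vacuity), word for word `IwasawaSelmerDualProofs` (Z) -/

section Existence

open Literature.NumberTheory.EllipticCurves.IwasawaAlgebra Literature.NumberTheory.EllipticCurves.IwasawaDual
  Literature.NumberTheory.EllipticCurves.ZpExtension

variable {K : Type u} [Field K] [NumberField K] (W : WeierstrassCurve K) {p : ℕ} [Fact p.Prime]
  (κ : ZpExtension K p)

/-- Every class of `Sel^{rel ∞}_{p^∞}(E/K_∞)` is killed by a power of `p` (it is a class of `H¹(K_∞, E[p^∞])`,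
`exists_pow_smul_subgroupH1_ker_eq_zero`). [cite: GreenbergLNM1716, §1 p. 60 (after Conj. 1.3)] -/
theorem exists_pow_smul_selmerInftyRelaxedInf_eq_zero (s : W.selmerInftyRelaxedInf κ) : ∃ k : ℕ, p ^ k • s = 0 := by
  obtain ⟨k, hk⟩ := W.exists_pow_smul_subgroupH1_ker_eq_zero κ (s : W.subgroupH1 p κ.kerSubgroup)
  exact ⟨k, Subtype.ext (by rw [AddSubgroupClass.coe_nsmul]; exact hk)⟩

/-- `conj_γ` restricted to an endomorphism of `Sel^{rel ∞}_{p^∞}(E/K_∞)` (it preserves it by `conjH1_mem_selmerInftyRelaxedInf`).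
[cite: GreenbergLNM1716, §1 p. 60 (after Conj. 1.3)] -/
def conjSelmerInftyRelaxedInf (γ : Field.absoluteGaloisGroup K) : AddMonoid.End (W.selmerInftyRelaxedInf κ) :=
  ((W.conjH1 p κ.kerSubgroup γ).restrict (W.selmerInftyRelaxedInf κ)).codRestrict (W.selmerInftyRelaxedInf κ) fun s ↦
    W.conjH1_mem_selmerInftyRelaxedInf κ γ s.2

/-- Unfolding `conjSelmerInftyRelaxedInf` (definitional). [cite: GreenbergLNM1716, §1 p. 60 (after Conj. 1.3)] -/
@[simp]
theorem coe_conjSelmerInftyRelaxedInf_apply (γ : Field.absoluteGaloisGroup K) (s : W.selmerInftyRelaxedInf κ) :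
    ((W.conjSelmerInftyRelaxedInf κ γ s : W.selmerInftyRelaxedInf κ) : W.subgroupH1 p κ.kerSubgroup) =
      W.conjH1 p κ.kerSubgroup γ s :=
  rfl

/-- Powers of the restriction are restrictions of `conj_{γ^m}`. [cite: GreenbergLNM1716, §1 p. 60 (after Conj. 1.3)] -/
theorem coe_conjSelmerInftyRelaxedInf_pow_apply (γ : Field.absoluteGaloisGroup K) (m : ℕ)
    (s : W.selmerInftyRelaxedInf κ) :
    ((((W.conjSelmerInftyRelaxedInf κ γ) ^ m) s : W.selmerInftyRelaxedInf κ) : W.subgroupH1 p κ.kerSubgroup) =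
      W.conjH1 p κ.kerSubgroup (γ ^ m) s := by
  induction m generalizing s with
  | zero => rw [pow_zero, pow_zero, AddMonoid.End.one_apply, W.conjH1_one_holds p κ.kerSubgroup,
      AddMonoidHom.id_apply]
  | succ m ih =>
    rw [pow_succ, AddMonoid.End.coe_mul, Function.comp_apply, ih, coe_conjSelmerInftyRelaxedInf_apply, pow_succ,
      W.conjH1_mul_holds p κ.kerSubgroup, AddMonoidHom.comp_apply]

/-- `Sel^{rel ∞}_{p^∞}(E/K_∞)` is `p`-primary and `T = γ − 1` is locally nilpotent on it, for `γ` a topological generator (both are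
statements about all of `H¹(K_∞, E[p^∞])`). [cite: GreenbergLNM1716, §1 p. 60 (after Conj. 1.3)] -/
theorem isLocNil_conjSelmerInftyRelaxedInf_sub_one {γ : Field.absoluteGaloisGroup K} (hγ : κ.IsTopGenerator γ) :
    IwasawaDual.IsLocNil p (W.conjSelmerInftyRelaxedInf κ γ - 1) := by
  have htor : ∀ s : W.selmerInftyRelaxedInf κ, ∃ k : ℕ, p ^ k • s = 0 :=
    W.exists_pow_smul_selmerInftyRelaxedInf_eq_zero κ
  refine ⟨htor, fun s ↦ ?_⟩
  obtain ⟨a, ha⟩ := W.exists_conjH1_pow_prime_pow_eq κ hγ (s : W.subgroupH1 p κ.kerSubgroup)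
  obtain ⟨k, hk⟩ := htor s
  have hφ : ((W.conjSelmerInftyRelaxedInf κ γ) ^ p ^ a) s = s :=
    Subtype.ext (by rw [coe_conjSelmerInftyRelaxedInf_pow_apply]; exact ha)
  exact ⟨k * p ^ a, IwasawaDual.pow_mul_prime_pow_apply_eq_zero (Fact.out : p.Prime) _ a hφ hk⟩

/-- **The dual `X^{rel ∞}(E/K_∞) = Hom(Sel^{rel ∞}_{p^∞}(E/K_∞), ℚ/ℤ)` with its `Λ`-module structure**, packaged as
`W.SelmerDualDataRelaxedInf κ γ` (`X` = the character group, `toDual = id`, module structure `IsLocNil.module`).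
[cite: GreenbergLNM1716, §1 p. 60 (after Conj. 1.3)] [cite: CoatesSujatha2005, §3] -/
def selmerDualDataRelaxedInf {γ : Field.absoluteGaloisGroup K} (hγ : κ.IsTopGenerator γ) :
    W.SelmerDualDataRelaxedInf κ γ :=
  { X := W.selmerInftyRelaxedInf κ →+ AddCircle (1 : ℚ)
    module := (W.isLocNil_conjSelmerInftyRelaxedInf_sub_one κ hγ).module
    toDual := AddMonoidHom.id _
    bijective := Function.bijective_id
    toDual_T_smul := fun x s ↦ by
      show (W.isLocNil_conjSelmerInftyRelaxedInf_sub_one κ hγ).smulFun PowerSeries.X x s = x _ - x s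
      rw [(W.isLocNil_conjSelmerInftyRelaxedInf_sub_one κ hγ).smulFun_X_apply,
        IwasawaDual.End_sub_apply, AddMonoid.End.one_apply, map_sub]
      rfl
    toDual_C_smul := fun c x s k hk ↦ by
      show (W.isLocNil_conjSelmerInftyRelaxedInf_sub_one κ hγ).smulFun (PowerSeries.C c) x s = _
      exact (W.isLocNil_conjSelmerInftyRelaxedInf_sub_one κ hγ).smulFun_C_apply c x hk }

/-- **Existence / non-vacuity**: for `γ` a topological generator, `W.SelmerDualDataRelaxedInf κ γ` is inhabited.
[cite: GreenbergLNM1716, §1 p. 60 (after Conj. 1.3)] [cite: CoatesSujatha2005, §3] -/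
theorem nonempty_selmerDualDataRelaxedInf {γ : Field.absoluteGaloisGroup K} (hγ : κ.IsTopGenerator γ) :
    Nonempty (W.SelmerDualDataRelaxedInf κ γ) :=
  ⟨W.selmerDualDataRelaxedInf κ hγ⟩

/-- For EVERY `ℤ_p`-extension `κ` the relaxed-at-`∞` dual Selmer datum exists for some topological generator `γ`.
[cite: GreenbergLNM1716, §1 p. 60 (after Conj. 1.3)] [cite: CoatesSujatha2005, §3] -/
theorem exists_selmerDualDataRelaxedInf :
    ∃ (γ : Field.absoluteGaloisGroup K) (_ : κ.IsTopGenerator γ), Nonempty (W.SelmerDualDataRelaxedInf κ γ) :=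
  have ⟨γ, hγ⟩ : ∃ γ : Field.absoluteGaloisGroup K, κ.IsTopGenerator γ :=
    κ.surjective (Multiplicative.ofAdd 1)
  ⟨γ, hγ, W.nonempty_selmerDualDataRelaxedInf κ hγ⟩

end Existence

end WeierstrassCurve

end
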